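import Summits.AtomisticToContinuum.Crystallization.Theorems.SquareWellLayerCakeGapTwelveToBarlowCombinatorialLayeringTransportSteps1
import Summits.AtomisticToContinuum.Crystallization.Theorems.SquareWellLayerCakeGapTwelveToBarlowCombinatorialLayeringTransportSteps2
import Summits.AtomisticToContinuum.Crystallization.Theorems.SquareWellLayerCakeGapTwelveToBarlowCombinatorialLayeringTransportSteps3
import Summits.AtomisticToContinuum.Crystallization.Theorems.SquareWellLayerCakeGapTwelveToBarlowCombinatorialLayeringTransportSteps5
import Summits.AtomisticToContinuum.Crystallization.Theorems.SquareWellLayerCakeGapTwelveToBarlowCombinatorialLayeringTransportVinv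
import Summits.AtomisticToContinuum.Crystallization.Theorems.SquareWellLayerCakeGapTwelveToBarlowCombinatorialLayeringTransportAttach1
import Summits.AtomisticToContinuum.Crystallization.Theorems.SquareWellLayerCakeGapTwelveToBarlowCombinatorialLayeringTransportAttach2
import Summits.AtomisticToContinuum.Crystallization.Theorems.SquareWellLayerCakeGapTwelveToBarlowCombinatorialLayeringTransportComm1
import Summits.AtomisticToContinuum.Crystallization.Theorems.SquareWellLayerCakeGapTwelveToBarlowCombinatorialLayeringTransportComm2
import Summits.AtomisticToContinuum.Crystallization.Theorems.SquareWellLayerCakeGapTwelveToBarlowCombinatorialLayeringTransportComm3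
import Summits.AtomisticToContinuum.Crystallization.Theorems.SquareWellLayerCakeGapTwelveToBarlowCombinatorialLayeringTransportVComm1
import Summits.AtomisticToContinuum.Crystallization.Theorems.SquareWellLayerCakeGapTwelveToBarlowCombinatorialLayeringTransportVComm2
import Summits.AtomisticToContinuum.Crystallization.Theorems.SquareWellLayerCakeGapTwelveToBarlowCombinatorialLayeringTransportVComm2b

/-!
# Combinatorial layering (B1a of `GapTwelveToBarlow`): transport port, part `VComm3`

Crux `SquareWellLayerCake.GapTwelveToBarlow` (stmt-AtomisticToContinuum-15807), line `Sketch`,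
stub `stub_combinatorialLayering`, residual `(H_develop)`.  PORT of the tree file
`PalmUnimodularRigidityShellsToBarlowChartTransportVComm3.lean` (crux 9227) to GRADED COMBINATORIAL
charts, following the port rules recorded in `…CombinatorialLayeringTransportSteps1` (bundled
standing hypothesis `hch` on `S : ℕ → Set E3`, abstract bond relation `B`, memberships
`x ∈ S (n + k)`, transfer as an input).  Statements and proofs are otherwise those of the source,
whose documentation follows.

# Line `develop-the-model-growth-descent` (crux `ShellsToBarlowChart`, stmt-AtomisticToContinuum-9227): commutation of `V⁻¹` with `I` and `J` (part 3/3)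

Helper lemmas for `stub_transportSystem` (the geometric half of the line): frames `⟨x, t₁, t₂, U⟩`
read in the integer charts `IsZChart` of a good-shell configuration, their transports and the
coherence of the resulting development `frameAt`.  The only metric inputs are the chart transfer
lemma and `bond_nb_iff`; everything else is label combinatorics in `ℤ³` (pattern facts
`TransportPatterns*`).  All `[folklore]` (HalesDSP2012 §1.3 for the two kissing patterns).
-/

noncomputable section

namespace Summit.AtomisticToContinuum.Crystallization.Theorems.SquareWellLayerCakeGapTwelveToBarlow

open Literature.Geometry.DiscreteGeometry Literature.MathematicalPhysics.StatisticalMechanics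
open Summit.AtomisticToContinuum.Crystallization.Theorems.PalmUnimodularRigidityShellsToBarlowChart hiding
  IsZChart TransportSystem scales_tied sqNormInt_transfer bond_symm nb_mem zlab_spec zlab_nb
  bond_nb_iff pattern_cases transfer_nb_nb transfer_nb_centre transfer_nb_target
  sqNormInt_zlab_centre hcp_of_mirror_pair Istep_spec Jstep_spec IinvStep_spec JinvStep_spec
  capWithAny_of_mem_cap IinvStep_Istep Istep_IinvStep JinvStep_Jstep Jstep_JinvStep polar_at_apex
  onesided_at_apex Vstep_spec nb_inj Istep_lower Jstep_lower IinvStep_lower JinvStep_lower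
  polar_at_lower_apex onesided_at_lower_apex VinvStep_spec attach_I_even attach_I_odd
  attach_lower_I_pos attach_lower_I_neg attach_J_even attach_J_odd Vstep_Istep_pt Vstep_Istep_back
  Vstep_Istep_side Vstep_Jstep_pt Vstep_Istep_comm Vstep_Jstep_comm attach_lower_J_pos
  attach_lower_J_neg VinvStep_Istep_pt VinvStep_Jstep_pt VinvStep_Istep_back VinvStep_Istep_side
  VinvStep_Istep_comm VinvStep_Jstep_comm Istep_Jstep_comm

variable {S : ℕ → Set (EuclideanSpace ℝ (Fin 3))}
  {B : EuclideanSpace ℝ (Fin 3) → EuclideanSpace ℝ (Fin 3) → Prop}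
  {Pc : EuclideanSpace ℝ (Fin 3) → Finset (Fin 3 → ℤ)}
  {nb : EuclideanSpace ℝ (Fin 3) → (Fin 3 → ℤ) → EuclideanSpace ℝ (Fin 3)}

variable
  (hch : (∀ n : ℕ, ∀ z ∈ S n, (Pc z = fcc3Int ∨ Pc z = hcpInt) ∧
      Set.BijOn (nb z) (↑(Pc z) : Set (Fin 3 → ℤ)) {y | B z y} ∧
      ∀ t ∈ Pc z, ∀ t' ∈ Pc z, (B (nb z t) (nb z t') ↔ sqNormInt (t - t') = 18)) ∧
    (∀ n : ℕ, ∀ z ∈ S (n + 1), ∀ y, B z y → y ∈ S n) ∧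
    (∀ n m : ℕ, ∀ x ∈ S n, ∀ y ∈ S m, B x y →
      ∀ (z z' : EuclideanSpace ℝ (Fin 3)) (t t' u u' : Fin 3 → ℤ),
        (t = 0 ∧ z = x ∨ t ∈ Pc x ∧ z = nb x t) → (t' = 0 ∧ z' = x ∨ t' ∈ Pc x ∧ z' = nb x t') →
        (u = 0 ∧ z = y ∨ u ∈ Pc y ∧ z = nb y u) → (u' = 0 ∧ z' = y ∨ u' ∈ Pc y ∧ z' = nb y u') →
        sqNormInt (u - u') = sqNormInt (t - t')) ∧
    (∀ x y, B x y → B y x))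

include hch


/-- **`V⁻¹ ∘ I = I ∘ V⁻¹` (layer `k → k−1` coherence).**  For a valid frame `g` whose layer-`k`
neighbourhood is valid and which commutes with the in-layer steps, the frame transported first
along `t₁` and then down equals the frame transported first down and then along its own `t₁`.
[folklore] -/
theorem VinvStep_Istep_comm {n : ℕ} {x : (EuclideanSpace ℝ (Fin 3))} (hx : x ∈ S (n + 4)) {t₁ t₂ : Fin 3 → ℤ} {U : Finset (Fin 3 → ℤ)} (hU : IsFrame (Pc x) t₁ t₂ U) (hI : IsFrame (Pc (nb x t₁)) (Istep Pc nb ⟨x, t₁, t₂, U⟩).t₁ (Istep Pc nb ⟨x, t₁, t₂, U⟩).t₂ (Istep Pc nb ⟨x, t₁, t₂, U⟩).U) (hJ : IsFrame (Pc (nb x t₂)) (Jstep Pc nb ⟨x, t₁, t₂, U⟩).t₁ (Jstep Pc nb ⟨x, t₁, t₂, U⟩).t₂ (Jstep Pc nb ⟨x, t₁, t₂, U⟩).U) (hIi : IsFrame (Pc (nb x (-t₁))) (IinvStep Pc nb ⟨x, t₁, t₂, U⟩).t₁ (IinvStep Pc nb ⟨x, t₁, t₂, U⟩).t₂ (IinvStep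 Pc nb ⟨x, t₁, t₂, U⟩).U) (hJi : IsFrame (Pc (nb x (-t₂))) (JinvStep Pc nb ⟨x, t₁, t₂, U⟩).t₁ (JinvStep Pc nb ⟨x, t₁, t₂, U⟩).t₂ (JinvStep Pc nb ⟨x, t₁, t₂, U⟩).U) (hII : IsFrame (Pc (nb (nb x t₁) (Istep Pc nb ⟨x, t₁, t₂, U⟩).t₁)) (Istep Pc nb (Istep Pc nb ⟨x, t₁, t₂, U⟩)).t₁ (Istep Pc nb (Istep Pc nb ⟨x, t₁, t₂, U⟩)).t₂ (Istep Pc nb (Istep Pc nb ⟨x, t₁, t₂, U⟩)).U) (hJI : IsFrame (Pc (nb (nb x t₁) (Istep Pc nb ⟨x, t₁, t₂, U⟩).t₂)) (Jstep Pc nb (Istep Pc nb ⟨x, t₁, t₂, U⟩)).t₁ (Jstep Pc nb (Istep Pc nb ⟨x, t₁, t₂, U⟩)).t₂ (Jstep Pc nb (Istep Pc nb ⟨x, t₁, t₂, U⟩)).U) (hIiI : IsFrame (Pc (nb (nb x t₁) (-(Istep Pc nb ⟨x, t₁, t₂, U⟩).t₁))) (IinvStep Pc nb (Istep Pc nb ⟨x,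 t₁, t₂, U⟩)).t₁ (IinvStep Pc nb (Istep Pc nb ⟨x, t₁, t₂, U⟩)).t₂ (IinvStep Pc nb (Istep Pc nb ⟨x, t₁, t₂, U⟩)).U) (hJiI : IsFrame (Pc (nb (nb x t₁) (-(Istep Pc nb ⟨x, t₁, t₂, U⟩).t₂))) (JinvStep Pc nb (Istep Pc nb ⟨x, t₁, t₂, U⟩)).t₁ (JinvStep Pc nb (Istep Pc nb ⟨x, t₁, t₂, U⟩)).t₂ (JinvStep Pc nb (Istep Pc nb ⟨x, t₁, t₂, U⟩)).U) (hcomm : Istep Pc nb (Jstep Pc nb ⟨x, t₁, t₂, U⟩) = Jstep Pc nb (Istep Pc nb ⟨x, t₁, t₂, U⟩)) : VinvStep Pc nb (Istep Pc nb ⟨x, t₁, t₂, U⟩) = Istep Pc nb (VinvStep Pc nb ⟨x, t₁, t₂, U⟩) := by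
  have hregI := hregI_of_valid (Pc := Pc) (nb := nb) hI
  obtain ⟨hyS, hbxy, hwP, hwx, -, -, -, -, -, -, -, hframe, hparI, -⟩ := Istep_spec hch hx hU hregI
  obtain ⟨hd'L, hdS, hbd, hξP, hξx, hframeVi, -, hbr⟩ := VinvStep_spec hch hx hU hI hJ hIi hJi
  obtain ⟨hpt, hbdd₁, -⟩ := VinvStep_Istep_pt hch hx hU hI hJ hIi hJi
  obtain ⟨hα, -⟩ := VinvStep_Istep_back hch hx hU hI hJ hIi hJi hII hJI hIiI hJiI
  obtain ⟨hβ, -⟩ := VinvStep_Istep_side hch hx hU hI hJ hIi hJi hII hJI hIiI hJiI hcomm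
  obtain ⟨hptJ, -, -⟩ := VinvStep_Jstep_pt hch hx hU hI hJ hIi hJi
  have hPx := pattern_cases hch hx
  have hPy := pattern_cases hch hyS
  have hPd := pattern_cases hch hdS
  obtain ⟨h12, hhex, hUP, -, -⟩ := id hU
  have ht₁ : t₁ ∈ Pc x := hhex (mem_hexLabels_iff.2 (Or.inl rfl))
  have ht₂ : t₂ ∈ Pc x := hhex (mem_hexLabels_iff.2 (Or.inr (Or.inl rfl)))
  -- canonical names at `x`: `d', d, τ₁, τ₂, Ud`
  set d' := apexOf t₁ t₂ (lowerCap (Pc x) t₁ t₂ U) with hd'_def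
  have hd'P : d' ∈ Pc x := (mem_lowerCap_iff.1 hd'L).1
  have hVpt : (VinvStep Pc nb ⟨x, t₁, t₂, U⟩).pt = nb x d' := rfl
  rw [hVpt] at *
  set d := nb x d' with hd_def
  set τ₁ := (VinvStep Pc nb ⟨x, t₁, t₂, U⟩).t₁ with hτ₁_def
  set τ₂ := (VinvStep Pc nb ⟨x, t₁, t₂, U⟩).t₂ with hτ₂_def
  set Ud := (VinvStep Pc nb ⟨x, t₁, t₂, U⟩).U with hUd_def
  have hVeq : VinvStep Pc nb ⟨x, t₁, t₂, U⟩ = ⟨d, τ₁, τ₂, Ud⟩ := rfl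
  obtain ⟨h12d, hhexd, hUdP, hoffd, -⟩ := id hframeVi
  have hτ₁P : τ₁ ∈ Pc d := hhexd (mem_hexLabels_iff.2 (Or.inl rfl))
  have hτ₂P : τ₂ ∈ Pc d := hhexd (mem_hexLabels_iff.2 (Or.inr (Or.inl rfl)))
  -- the frame `I g = ⟨y, a', b', U'⟩`
  set a' := (Istep Pc nb ⟨x, t₁, t₂, U⟩).t₁ with ha'
  set b' := (Istep Pc nb ⟨x, t₁, t₂, U⟩).t₂ with hb'
  set U' := (Istep Pc nb ⟨x, t₁, t₂, U⟩).U with hU'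
  have hIeq : Istep Pc nb ⟨x, t₁, t₂, U⟩ = ⟨nb x t₁, a', b', U'⟩ := rfl
  rw [hIeq] at hII hJI hIiI hJiI hpt hbdd₁ hα hβ ⊢
  obtain ⟨hdL'L, hd₁S, hbyd₁, hξ'P, hξ'y, hframeVi', -, hbr'⟩ :=
    VinvStep_spec hch hyS hframe hII hJI hIiI hJiI
  set dL' := apexOf a' b' (lowerCap (Pc (nb x t₁)) a' b' U') with hdL'_def
  have hdL'P : dL' ∈ Pc (nb x t₁) := (mem_lowerCap_iff.1 hdL'L).1
  have hV'pt : (VinvStep Pc nb ⟨nb x t₁, a', b', U'⟩).pt = nb (nb x t₁) dL' := rfl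
  rw [hV'pt] at *
  set d₁ := nb (nb x t₁) dL' with hd₁_def
  set τ₁'' := (VinvStep Pc nb ⟨nb x t₁, a', b', U'⟩).t₁ with hτ₁''_def
  set τ₂'' := (VinvStep Pc nb ⟨nb x t₁, a', b', U'⟩).t₂ with hτ₂''_def
  set U₁ := (VinvStep Pc nb ⟨nb x t₁, a', b', U'⟩).U with hU₁_def
  have hV'eq : VinvStep Pc nb ⟨nb x t₁, a', b', U'⟩ = ⟨d₁, τ₁'', τ₂'', U₁⟩ := rfl
  have hPd₁ := pattern_cases hch hd₁S
  obtain ⟨h12'', hhex'', -, -, -⟩ := id hframeVi'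
  have hτ₁''P : τ₁'' ∈ Pc d₁ := hhex'' (mem_hexLabels_iff.2 (Or.inl rfl))
  have hτ12''P : τ₁'' - τ₂'' ∈ Pc d₁ :=
    hhex'' (mem_hexLabels_iff.2 (Or.inr (Or.inr (Or.inr (Or.inr (Or.inr rfl))))))
  -- the three identifications
  have hd₁' : nb d τ₁ = d₁ := hpt.symm
  have hw' : zlab Pc nb d₁ d = -τ₁'' := hα
  rw [hVeq] at hptJ
  have hdJ : nb d τ₂ = (VinvStep Pc nb (Jstep Pc nb ⟨x, t₁, t₂, U⟩)).pt := hptJ.symm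
  have hv' : zlab Pc nb d₁ (nb d τ₂) = τ₂'' - τ₁'' := by rw [hdJ]; exact hβ
  -- the I-step of `V⁻¹ g` (layer `k−1`)
  have hreg3 : Pc (nb d τ₁) = fcc3Int ∨ Pc d = hcpInt ∨
      (-zlab Pc nb (nb d τ₁) d ∈ Pc (nb d τ₁) ∧ -zlab Pc nb (nb d τ₁) (nb d τ₂) ∈ Pc (nb d τ₁)) := by
    refine Or.inr (Or.inr ⟨?_, ?_⟩)
    · rw [hd₁', hw', neg_neg]; exact hτ₁''P
    · rw [hd₁', hv', neg_sub]; exact hτ12''P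
  obtain ⟨-, -, -, -, -, -, -, -, -, -, -, -, -, c₁, hc₁U, -, hfilt₁, hbur, hrU, hUeq₂, -⟩ :=
    Istep_spec hch hdS hframeVi hreg3
  have ept : (Istep Pc nb ⟨d, τ₁, τ₂, Ud⟩).pt = d₁ := hd₁'
  have e₁ : (Istep Pc nb ⟨d, τ₁, τ₂, Ud⟩).t₁ = τ₁'' := by
    show -zlab Pc nb (nb d τ₁) d = τ₁''
    rw [hd₁', hw', neg_neg]
  have e₂ : (Istep Pc nb ⟨d, τ₁, τ₂, Ud⟩).t₂ = τ₂'' := by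
    show zlab Pc nb (nb d τ₁) (nb d τ₂) - zlab Pc nb (nb d τ₁) d = τ₂''
    rw [hd₁', hv', hw']; abel
  rw [hd₁'] at hbur hrU hUeq₂
  rw [e₁, e₂] at hUeq₂
  -- the transported reference `r = zlab d₁ (nb d c₁)` is the label of `x` (letter `+1`) or of `Ix`
  -- (letter `−1`) at `d₁`, hence lies in `U₁`
  have hrU₁ : zlab Pc nb d₁ (nb d c₁) ∈ U₁ := by
    have hξoff : zlab Pc nb d x ∉ hexLabels τ₁ τ₂ := by
      rcases hbr with ⟨-, hUd, -, -, -⟩ | ⟨-, hUd, -, -, -⟩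
      · exact hoffd _ (by rw [hUd]; simp)
      · exact hoffd _ (by rw [hUd]; simp)
    rcases hbr with ⟨hlp, hUd, hnI, -, -⟩ | ⟨hlp, hUd, hnI, -, -⟩
    · -- `Ud = {ξ, ξ − τ₁, ξ − τ₂}`: the element touching `τ₁` is `ξ`, so `nb d c₁ = x`
      have hx1 : zlab Pc nb d x - τ₁ ∈ Pc d := hUdP (by rw [hUd]; simp)
      have hx2 : zlab Pc nb d x - τ₂ ∈ Pc d := hUdP (by rw [hUd]; simp)
      have hc₁ : c₁ = zlab Pc nb d x := by
        have h1 := (filter_evenCap (Pc d) hPd τ₁ hτ₁P τ₂ hτ₂P _ hξP h12d hhexd hξoff hx1 hx2).1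
        rw [← hUd, hfilt₁] at h1
        exact Finset.singleton_injective h1
      rw [hc₁, hξx]
      -- `x` has label `ξ' − τ₁''` at `d₁`
      rcases hbr' with ⟨-, hUd₁, hnI', -, -⟩ | ⟨hlp'', -, -, -, -⟩
      swap
      · obtain ⟨hlp', -, -⟩ := attach_lower_I_pos hch hx hU hlp hregI
        rw [hIeq] at hlp'
        exact absurd (hlp'.symm.trans hlp'') (by norm_num)
      have hyx : nb (nb x t₁) (-a') = x := by
        show nb (nb x t₁) (-(-zlab Pc nb (nb x t₁) x)) = x
        rw [neg_neg]; exact hwx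
      rw [hyx] at hnI'
      have hmem : zlab Pc nb d₁ (nb x t₁) - τ₁'' ∈ U₁ := by rw [hUd₁]; simp
      have hlab : zlab Pc nb d₁ x = zlab Pc nb d₁ (nb x t₁) - τ₁'' := by
        have h := zlab_nb hch hd₁S (hframeVi'.2.2.1 hmem)
        rwa [hnI'] at h
      rw [hlab]; exact hmem
    · -- `Ud = {ξ, ξ + τ₁, ξ + τ₂}`: the element touching `τ₁` is `ξ + τ₁`, so `nb d c₁ = Ix`
      have hx1 : zlab Pc nb d x + τ₁ ∈ Pc d := hUdP (by rw [hUd]; simp)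
      have hx2 : zlab Pc nb d x + τ₂ ∈ Pc d := hUdP (by rw [hUd]; simp)
      have hc₁ : c₁ = zlab Pc nb d x + τ₁ := by
        have h1 := (filter_oddCap (Pc d) hPd τ₁ hτ₁P τ₂ hτ₂P _ hξP h12d hhexd hξoff hx1 hx2).1
        rw [← hUd, hfilt₁] at h1
        exact Finset.singleton_injective h1
      rw [hc₁, hnI]
      rcases hbr' with ⟨hlp'', -, -, -, -⟩ | ⟨-, hUd₁, -, -, -⟩
      · obtain ⟨hlp', -, -⟩ := attach_lower_I_neg hch hx hU hlp hregI
        rw [hIeq] at hlp'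
        exact absurd (hlp'.symm.trans hlp'') (by norm_num)
      rw [hUd₁]; simp
  have hU₂ : (Istep Pc nb ⟨d, τ₁, τ₂, Ud⟩).U = U₁ := by
    rw [hUeq₂]; exact capWithAny_of_mem_cap hch hd₁S hframeVi' hrU₁
  rw [hVeq, hV'eq]
  exact (ZFrame.ext' ept e₁ e₂ hU₂).symm

/-- **`V⁻¹ ∘ J = J ∘ V⁻¹`**, from `VinvStep_Istep_comm` by the swap symmetry. [folklore] -/
theorem VinvStep_Jstep_comm {n : ℕ} {x : (EuclideanSpace ℝ (Fin 3))}
    (hx : x ∈ S (n + 4)) {t₁ t₂ : Fin 3 → ℤ} {U : Finset (Fin 3 → ℤ)} (hU : IsFrame (Pc x) t₁ t₂ U)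
    (hI : IsFrame (Pc (nb x t₁)) (Istep Pc nb ⟨x, t₁, t₂, U⟩).t₁ (Istep Pc nb ⟨x, t₁, t₂, U⟩).t₂
      (Istep Pc nb ⟨x, t₁, t₂, U⟩).U)
    (hJ : IsFrame (Pc (nb x t₂)) (Jstep Pc nb ⟨x, t₁, t₂, U⟩).t₁ (Jstep Pc nb ⟨x, t₁, t₂, U⟩).t₂
      (Jstep Pc nb ⟨x, t₁, t₂, U⟩).U)
    (hIi : IsFrame (Pc (nb x (-t₁))) (IinvStep Pc nb ⟨x, t₁, t₂, U⟩).t₁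
      (IinvStep Pc nb ⟨x, t₁, t₂, U⟩).t₂ (IinvStep Pc nb ⟨x, t₁, t₂, U⟩).U)
    (hJi : IsFrame (Pc (nb x (-t₂))) (JinvStep Pc nb ⟨x, t₁, t₂, U⟩).t₁
      (JinvStep Pc nb ⟨x, t₁, t₂, U⟩).t₂ (JinvStep Pc nb ⟨x, t₁, t₂, U⟩).U)
    (hJJ : IsFrame (Pc (nb (nb x t₂) (Jstep Pc nb ⟨x, t₁, t₂, U⟩).t₂))
      (Jstep Pc nb (Jstep Pc nb ⟨x, t₁, t₂, U⟩)).t₁ (Jstep Pc nb (Jstep Pc nb ⟨x, t₁, t₂, U⟩)).t₂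
      (Jstep Pc nb (Jstep Pc nb ⟨x, t₁, t₂, U⟩)).U)
    (hIJ : IsFrame (Pc (nb (nb x t₂) (Jstep Pc nb ⟨x, t₁, t₂, U⟩).t₁))
      (Istep Pc nb (Jstep Pc nb ⟨x, t₁, t₂, U⟩)).t₁ (Istep Pc nb (Jstep Pc nb ⟨x, t₁, t₂, U⟩)).t₂
      (Istep Pc nb (Jstep Pc nb ⟨x, t₁, t₂, U⟩)).U)
    (hJiJ : IsFrame (Pc (nb (nb x t₂) (-(Jstep Pc nb ⟨x, t₁, t₂, U⟩).t₂)))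
      (JinvStep Pc nb (Jstep Pc nb ⟨x, t₁, t₂, U⟩)).t₁ (JinvStep Pc nb (Jstep Pc nb ⟨x, t₁, t₂, U⟩)).t₂
      (JinvStep Pc nb (Jstep Pc nb ⟨x, t₁, t₂, U⟩)).U)
    (hIiJ : IsFrame (Pc (nb (nb x t₂) (-(Jstep Pc nb ⟨x, t₁, t₂, U⟩).t₁)))
      (IinvStep Pc nb (Jstep Pc nb ⟨x, t₁, t₂, U⟩)).t₁ (IinvStep Pc nb (Jstep Pc nb ⟨x, t₁, t₂, U⟩)).t₂
      (IinvStep Pc nb (Jstep Pc nb ⟨x, t₁, t₂, U⟩)).U)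
    (hcomm : Istep Pc nb (Jstep Pc nb ⟨x, t₁, t₂, U⟩) = Jstep Pc nb (Istep Pc nb ⟨x, t₁, t₂, U⟩)) :
    VinvStep Pc nb (Jstep Pc nb ⟨x, t₁, t₂, U⟩) = Jstep Pc nb (VinvStep Pc nb ⟨x, t₁, t₂, U⟩) := by
  have hPx := pattern_cases hch hx
  have hU' : IsFrame (Pc x) t₂ t₁ U := isFrame_swap hU
  obtain ⟨hI', hJ', hIi', hJi'⟩ := swap_hyps (Pc := Pc) (nb := nb) hI hJ hIi hJi
  have hII' : IsFrame (Pc (nb (nb x t₂) (Istep Pc nb ⟨x, t₂, t₁, U⟩).t₁))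
      (Istep Pc nb (Istep Pc nb ⟨x, t₂, t₁, U⟩)).t₁ (Istep Pc nb (Istep Pc nb ⟨x, t₂, t₁, U⟩)).t₂
      (Istep Pc nb (Istep Pc nb ⟨x, t₂, t₁, U⟩)).U := by
    rw [Istep_swap x t₁ t₂ U, Istep_swap' (Jstep Pc nb ⟨x, t₁, t₂, U⟩)]
    exact isFrame_swap hJJ
  have hJI' : IsFrame (Pc (nb (nb x t₂) (Istep Pc nb ⟨x, t₂, t₁, U⟩).t₂))
      (Jstep Pc nb (Istep Pc nb ⟨x, t₂, t₁, U⟩)).t₁ (Jstep Pc nb (Istep Pc nb ⟨x, t₂, t₁, U⟩)).t₂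
      (Jstep Pc nb (Istep Pc nb ⟨x, t₂, t₁, U⟩)).U := by
    rw [Istep_swap x t₁ t₂ U, Jstep_swap' (Jstep Pc nb ⟨x, t₁, t₂, U⟩)]
    exact isFrame_swap hIJ
  have hIiI' : IsFrame (Pc (nb (nb x t₂) (-(Istep Pc nb ⟨x, t₂, t₁, U⟩).t₁)))
      (IinvStep Pc nb (Istep Pc nb ⟨x, t₂, t₁, U⟩)).t₁ (IinvStep Pc nb (Istep Pc nb ⟨x, t₂, t₁, U⟩)).t₂
      (IinvStep Pc nb (Istep Pc nb ⟨x, t₂, t₁, U⟩)).U := by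
    rw [Istep_swap x t₁ t₂ U, IinvStep_swap' (Jstep Pc nb ⟨x, t₁, t₂, U⟩)]
    exact isFrame_swap hJiJ
  have hJiI' : IsFrame (Pc (nb (nb x t₂) (-(Istep Pc nb ⟨x, t₂, t₁, U⟩).t₂)))
      (JinvStep Pc nb (Istep Pc nb ⟨x, t₂, t₁, U⟩)).t₁ (JinvStep Pc nb (Istep Pc nb ⟨x, t₂, t₁, U⟩)).t₂
      (JinvStep Pc nb (Istep Pc nb ⟨x, t₂, t₁, U⟩)).U := by
    rw [Istep_swap x t₁ t₂ U, JinvStep_swap' (Jstep Pc nb ⟨x, t₁, t₂, U⟩)]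
    exact isFrame_swap hIiJ
  have hcomm' : Istep Pc nb (Jstep Pc nb ⟨x, t₂, t₁, U⟩) = Jstep Pc nb (Istep Pc nb ⟨x, t₂, t₁, U⟩) := by
    rw [Jstep_swap x t₂ t₁ U, Istep_swap x t₁ t₂ U, Istep_swap' (Istep Pc nb ⟨x, t₁, t₂, U⟩),
      Jstep_swap' (Jstep Pc nb ⟨x, t₁, t₂, U⟩), hcomm]
  have key := VinvStep_Istep_comm hch hx hU' hI' hJ' hIi' hJi' hII' hJI' hIiI' hJiI' hcomm'
  have hregJ := hregJ_of_valid (Pc := Pc) (nb := nb) hJ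
  obtain ⟨hyJS, -, -, -, -, -, -, -, -, -, -, hJframe, -⟩ := Jstep_spec hch hx hU hregJ
  have hPyJ := pattern_cases hch hyJS
  obtain ⟨-, hdS, -, -, -, hframeVi, -⟩ := VinvStep_spec hch hx hU hI hJ hIi hJi
  have hPd := pattern_cases hch hdS
  rw [Istep_swap x t₁ t₂ U, VinvStep_swap hPx hU] at key
  rw [VinvStep_swap' (f := Jstep Pc nb ⟨x, t₁, t₂, U⟩) hPyJ hJframe] at key
  rw [Istep_swap' (Pc := Pc) (nb := nb) (VinvStep Pc nb ⟨x, t₁, t₂, U⟩)] at key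
  obtain ⟨h1, h2, h3, h4⟩ := ZFrame.mk.inj key
  exact ZFrame.ext' h1 h3 h2 h4

omit hch in
/-! ## Registered anchor (closed form) -/

omit hch in
/-- **Closed form of `VinvStep_Istep_comm`** (the registered anchor of this file): the section data
`S, B, Pc, nb` and the standing hypothesis written out, the frame packaged as a `ZFrame`
and the validity hypotheses of the transported frames as one quantified clause. [folklore] -/
theorem VinvStep_Istep_comm_graded :
    ∀ {S : ℕ → Set (EuclideanSpace ℝ (Fin 3))} {B : EuclideanSpace ℝ (Fin 3) → EuclideanSpace ℝ
    (Fin 3) → Prop} {Pc : EuclideanSpace ℝ (Fin 3) → Finset (Fin 3 → ℤ)} {nb : EuclideanSpace ℝ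
    (Fin 3) → (Fin 3 → ℤ) → EuclideanSpace ℝ (Fin 3)}, ((∀ n : ℕ, ∀ z ∈ S n, (Pc z =
    Summit.AtomisticToContinuum.Crystallization.Theorems.PalmUnimodularRigidityShellsToBarlowChart.fcc3Int
    ∨ Pc z = Literature.Geometry.DiscreteGeometry.hcpInt) ∧ Set.BijOn (nb z) (↑(Pc z) : Set (Fin
    3 → ℤ)) {y | B z y} ∧ ∀ t ∈ Pc z, ∀ t' ∈ Pc z, (B (nb z t) (nb z t') ↔
    Literature.Geometry.DiscreteGeometry.sqNormInt (t - t') = 18)) ∧ (∀ n : ℕ, ∀ z ∈ S (n + 1),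
    ∀ y, B z y → y ∈ S n) ∧ (∀ n m : ℕ, ∀ x ∈ S n, ∀ y ∈ S m, B x y → ∀ (z z' : EuclideanSpace ℝ
    (Fin 3)) (t t' u u' : Fin 3 → ℤ), (t = 0 ∧ z = x ∨ t ∈ Pc x ∧ z = nb x t) → (t' = 0 ∧ z' = x
    ∨ t' ∈ Pc x ∧ z' = nb x t') → (u = 0 ∧ z = y ∨ u ∈ Pc y ∧ z = nb y u) → (u' = 0 ∧ z' = y ∨
    u' ∈ Pc y ∧ z' = nb y u') → Literature.Geometry.DiscreteGeometry.sqNormInt (u - u') =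
    Literature.Geometry.DiscreteGeometry.sqNormInt (t - t')) ∧ (∀ x y, B x y → B y x)) → ∀ (n :
    ℕ) (f :
    Summit.AtomisticToContinuum.Crystallization.Theorems.PalmUnimodularRigidityShellsToBarlowChart.ZFrame),
    f.pt ∈ S (n + 4) → (∀ g :
    Summit.AtomisticToContinuum.Crystallization.Theorems.PalmUnimodularRigidityShellsToBarlowChart.ZFrame,
    g = f ∨ g =
    Summit.AtomisticToContinuum.Crystallization.Theorems.PalmUnimodularRigidityShellsToBarlowChart.Istep
    Pc nb f ∨ g =
    Summit.AtomisticToContinuum.Crystallization.Theorems.PalmUnimodularRigidityShellsToBarlowChart.Jstep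
    Pc nb f ∨ g =
    Summit.AtomisticToContinuum.Crystallization.Theorems.PalmUnimodularRigidityShellsToBarlowChart.IinvStep
    Pc nb f ∨ g =
    Summit.AtomisticToContinuum.Crystallization.Theorems.PalmUnimodularRigidityShellsToBarlowChart.JinvStep
    Pc nb f ∨ g =
    Summit.AtomisticToContinuum.Crystallization.Theorems.PalmUnimodularRigidityShellsToBarlowChart.Istep
    Pc nb
    (Summit.AtomisticToContinuum.Crystallization.Theorems.PalmUnimodularRigidityShellsToBarlowChart.Istep
    Pc nb f) ∨ g =
    Summit.AtomisticToContinuum.Crystallization.Theorems.PalmUnimodularRigidityShellsToBarlowChart.Jstep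
    Pc nb
    (Summit.AtomisticToContinuum.Crystallization.Theorems.PalmUnimodularRigidityShellsToBarlowChart.Istep
    Pc nb f) ∨ g =
    Summit.AtomisticToContinuum.Crystallization.Theorems.PalmUnimodularRigidityShellsToBarlowChart.IinvStep
    Pc nb
    (Summit.AtomisticToContinuum.Crystallization.Theorems.PalmUnimodularRigidityShellsToBarlowChart.Istep
    Pc nb f) ∨ g =
    Summit.AtomisticToContinuum.Crystallization.Theorems.PalmUnimodularRigidityShellsToBarlowChart.JinvStep
    Pc nb
    (Summit.AtomisticToContinuum.Crystallization.Theorems.PalmUnimodularRigidityShellsToBarlowChart.Istep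
    Pc nb f) →
    Summit.AtomisticToContinuum.Crystallization.Theorems.PalmUnimodularRigidityShellsToBarlowChart.IsFrame
    (Pc g.pt) g.t₁ g.t₂ g.U) →
    Summit.AtomisticToContinuum.Crystallization.Theorems.PalmUnimodularRigidityShellsToBarlowChart.Istep
    Pc nb
    (Summit.AtomisticToContinuum.Crystallization.Theorems.PalmUnimodularRigidityShellsToBarlowChart.Jstep
    Pc nb f) =
    Summit.AtomisticToContinuum.Crystallization.Theorems.PalmUnimodularRigidityShellsToBarlowChart.Jstep
    Pc nb
    (Summit.AtomisticToContinuum.Crystallization.Theorems.PalmUnimodularRigidityShellsToBarlowChart.Istep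
    Pc nb f) →
    Summit.AtomisticToContinuum.Crystallization.Theorems.PalmUnimodularRigidityShellsToBarlowChart.VinvStep
    Pc nb
    (Summit.AtomisticToContinuum.Crystallization.Theorems.PalmUnimodularRigidityShellsToBarlowChart.Istep
    Pc nb f) =
    Summit.AtomisticToContinuum.Crystallization.Theorems.PalmUnimodularRigidityShellsToBarlowChart.Istep
    Pc nb
    (Summit.AtomisticToContinuum.Crystallization.Theorems.PalmUnimodularRigidityShellsToBarlowChart.VinvStep
    Pc nb f) := by
  intro S B Pc nb hch n f hx hval hcomm
  obtain ⟨x, t₁, t₂, U⟩ := f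
  exact VinvStep_Istep_comm hch hx (hval _ (Or.inl rfl)) (hval _ (Or.inr (Or.inl rfl))) (hval _ (Or.inr (Or.inr (Or.inl rfl)))) (hval _ (Or.inr (Or.inr (Or.inr (Or.inl rfl))))) (hval _ (Or.inr (Or.inr (Or.inr (Or.inr (Or.inl rfl)))))) (hval _ (Or.inr (Or.inr (Or.inr (Or.inr (Or.inr (Or.inl rfl))))))) (hval _ (Or.inr (Or.inr (Or.inr (Or.inr (Or.inr (Or.inr (Or.inl rfl)))))))) (hval _ (Or.inr (Or.inr (Or.inr (Or.inr (Or.inr (Or.inr (Or.inr (Or.inl rfl))))))))) (hval _ (Or.inr (Or.inr (Or.inr (Or.inr (Or.inr (Or.inr (Or.inr (Or.inr (rfl)))))))))) hcomm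

end Summit.AtomisticToContinuum.Crystallization.Theorems.SquareWellLayerCakeGapTwelveToBarlow

end
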